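import Mathlib.AlgebraicGeometry.EllipticCurve.Affine.Point
import HarnessLib

/-!
# Points of a Weierstrass curve under a ring homomorphism of fields: `(x, y) ↦ (f x, f y)` is additive
# `W(L) → (W.map f)(L')`

Silverman, *AEC* VIII.§1 (and II.§2): a field homomorphism `f : L → L'` carries the points of a Weierstrass
equation `W` over `L` to points of the transported equation `W^f` (coefficients `f aᵢ`) over `L'`, compatibly
with the group law (the addition formulas are polynomial over the prime field), hence torsion to torsion —
in particular a field automorphism `σ` that does NOT fix the field of definition of `W` still maps `W[n]` to
`W^σ[n]` coordinatewise. Mathlib's `WeierstrassCurve.Affine.Point.map` is the special case of an algebra map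
over a base ring over which `W` is defined; this PROOF-ONLY file records the general ring-hom form as an
existence statement (no new definition): `Point.exists_addMonoidHom_map` — an additive map
`φ : W.toAffine.Point →+ (W.map f).toAffine.Point` with `φ (x, y) = (f x, f y)` and `φ 𝒪 = 𝒪`, injective;
and the torsion/coordinate corollary `Point.exists_map_torsion`.

Motivation (abc-iut cell, route IUTThetaPilot, reading v3 2026-08-26T02:33:05Z): Galois-stability over
`F_mod` of the generators `coords(E_λ[15])` of the field `F‡(P)` — `σ ∈ Gal(F̄/F_mod)` moves `λ` along the
anharmonic orbit and `E_λ[15]` to `E_{σλ}[15]`. [cite: SilvermanAEC2009, VIII.§1]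
-/

namespace WeierstrassCurve.Affine.Point

variable {L L' : Type*} [Field L] [Field L'] [DecidableEq L] [DecidableEq L'] (W : WeierstrassCurve L)
  (f : L →+* L')

/-- **Transport of points along a field homomorphism**: there is an additive map
`φ : W(L) → W^f(L')`, `W^f = W.map f`, with `φ 𝒪 = 𝒪` and `φ (x, y) = (f x, f y)` (the group law is given by
polynomial formulas, `map_addX`/`map_addY`/`map_slope`/`map_negY`). [cite: SilvermanAEC2009, VIII.§1] -/
theorem exists_addMonoidHom_map :
    ∃ φ : W.toAffine.Point →+ (W.map f).toAffine.Point,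
      φ 0 = 0 ∧ ∀ (x y : L) (h : W.toAffine.Nonsingular x y),
        φ (.some x y h) = .some (f x) (f y) ((W.toAffine.map_nonsingular f.injective x y).mpr h) := by
  let toFun : W.toAffine.Point → (W.map f).toAffine.Point := fun P => match P with
    | .zero => .zero
    | .some x y h => .some (f x) (f y) ((W.toAffine.map_nonsingular f.injective x y).mpr h)
  have h0 : toFun 0 = 0 := rfl
  have hsome : ∀ (x y : L) (h : W.toAffine.Nonsingular x y),
      toFun (.some x y h) = .some (f x) (f y) ((W.toAffine.map_nonsingular f.injective x y).mpr h) :=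
    fun _ _ _ => rfl
  refine ⟨{ toFun := toFun, map_zero' := h0, map_add' := ?_ }, h0, hsome⟩
  rintro (_ | ⟨x₁, y₁, h₁⟩) (_ | ⟨x₂, y₂, h₂⟩)
  · rfl
  · rfl
  · rfl
  · show toFun (Point.some x₁ y₁ h₁ + Point.some x₂ y₂ h₂) =
      toFun (Point.some x₁ y₁ h₁) + toFun (Point.some x₂ y₂ h₂)
    rw [hsome x₁ y₁ h₁, hsome x₂ y₂ h₂]
    by_cases hxy : x₁ = x₂ ∧ y₁ = W.toAffine.negY x₂ y₂
    · have hy' : f y₁ = (W.map f).toAffine.negY (f x₂) (f y₂) := by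
        rw [hxy.right]; exact (map_negY f x₂ y₂).symm
      rw [add_of_Y_eq hxy.left hxy.right, h0, add_of_Y_eq (congr_arg f hxy.left) hy']
    · have hxy' : ¬(f x₁ = f x₂ ∧ f y₁ = (W.map f).toAffine.negY (f x₂) (f y₂)) := by
        rintro ⟨hx, hy⟩
        refine hxy ⟨f.injective hx, f.injective ?_⟩
        rw [hy]
        exact map_negY f x₂ y₂
      rw [add_some hxy, add_some hxy']
      simp only [hsome, map_slope, map_addX, map_addY]

/-- **Torsion points and their coordinates along a field homomorphism**: for every `n`-torsion point
`T = (x, y)` of `W(L)` the point `(f x, f y)` is an `n`-torsion point of `W^f(L')`.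
[cite: SilvermanAEC2009, VIII.§1] -/
theorem exists_map_torsion {n : ℤ} {x y : L} (h : W.toAffine.Nonsingular x y)
    (hT : n • (Point.some x y h : W.toAffine.Point) = 0) :
    n • (Point.some (f x) (f y) ((W.toAffine.map_nonsingular f.injective x y).mpr h) :
      (W.map f).toAffine.Point) = 0 := by
  obtain ⟨φ, h0, hφ⟩ := exists_addMonoidHom_map W f
  rw [← hφ x y h, ← map_zsmul, hT, h0]

end WeierstrassCurve.Affine.Point
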